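import Mathlib.GroupTheory.IndexNormal
import Mathlib.GroupTheory.Nilpotent
import Mathlib.GroupTheory.Perm.Fin
import Mathlib.SetTheory.Cardinal.Finite
import Mathlib.Data.Finset.Preimage
import Literature.Computability.AlgebraicComplexity.PseudoExponentBounds
import HarnessLib

/-!
# A self-normalising subgroup of index `4` forces TPP capacity `≥ 3|G|/2` (Hedtke–Murthy 2012, Lemma 4.2)

Topic `Literature/Computability/AlgebraicComplexity` (group-theoretic matrix multiplication; companion of
`TPPCapacityIndexThree.lean` (Lemma 4.1), `CohnUmansTPP.lean` (`RealizesTPP`), `TPPGroupExtension.lean`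
(Cohn–Umans 2003 Lemma 2.2) and `PseudoExponentBounds.lean`).

I. Hedtke, S. Murthy, *Search and test algorithms for triple product property triples*, Groups Complex.
Cryptol. 4 (2012), doi:10.1515/gcc-2012-0006 = arXiv:1104.5097, §4, Lemma 4.2 (held text
`paper:arxiv-1104.5097` chunk p0008 L15–20), verbatim:

> **Lemma 4.2.** If `G` is a nonabelian group with a self-normalising subgroup `S` of index `[G:S] = 4`,
> then `β(G) ≥ (3/2) |G|`.
> *Proof.* The subgroup `S` has a normal core `K := Core_G(S) ⊴ G` which is proper `K < S`, such that the
> quotient group `G/K` is of order `|G/K| > |G/S| = 4`. The core `K` is the kernel of the natural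
> homomorphism `φ : G → S₄` which describes the permutation action of `G` on `G/S`, and so
> `G/K ≅ img φ ≤ S₄` is a transitive subgroup of order greater than `4`. The only possibilities are `A₄`,
> `D₈` and `S₄`. Because we assume that `S` is self-normalising, the case `G/K ≅ D₈` is not feasible. The
> statement follows from `β(A₄)/|A₄| = β(S₄)/|S₄| = 3/2` (see table (tab:small)) like in the proof of
> lemma (lem:NonAB). □  ("the proofs as formulated here are those of Neumann")

`β(G) = max {|S||T||U| : (S, T, U) a TPP triple of G}`; the tree has no `β` symbol, so the lemma is
rendered as the existence of a realization `⟨n, m, p⟩` with `2 nmp = 3 |G|`.  The proof follows the print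
with ONE substitution, recorded here: instead of the list of transitive subgroups of `S₄` ("`A₄`, `D₈`,
`S₄`") we use `[G : K] ∈ {8, 12, 24}` (`[G:K]` divides `4! = 24` and is a proper multiple of `4`) and
exclude `[G : K] = 8` — the print's "`D₈` is not feasible" — by the normaliser condition of finite
`2`-groups (Mathlib `IsPGroup.isNilpotent`, `Group.normalizerCondition_of_isNilpotent`): the image `S/K` of
the self-normalising `S` is self-normalising in `G/K` (`map_mk_normalizer_eq`), hence would be all of
`G/K`, contradicting `[G/K : S/K] = 4`.  For `[G : K] = 24` the faithful action gives `G/K ≅ S₄`, which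
realizes `⟨4, 3, 3⟩` (`36 = (3/2)·24`; witness below, checked by `decide`); for `[G : K] = 12` the image
of `G/K` in `S₄` has index `2`, so it contains every square, and every even permutation of `4` letters
is a square (`decide`), so it contains the `A₄`-witness of `⟨3, 3, 2⟩` (`18 = (3/2)·12`; the print's
`β(A₄) = 18`), which pulls back to `G/K` (`realizesTPP_of_tpp_subset_range`).  Cohn–Umans 2003 Lemma 2.2
(tree `CohnUmans2003_lemma22`) with `K` realizing `⟨|K|, 1, 1⟩` finishes: `G` realizes
`⟨4|K|, 3, 3⟩` or `⟨3|K|, 3, 2⟩`, of volume `(3/2)|G|` in both cases.  The printed hypothesis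
"nonabelian" is implied (a self-normalising proper subgroup is not normal) and is not repeated.

## What is here (all proved; 0 definitions, 0 named facts)

* `realizesTPP_of_tpp_subset_range` — a TPP triple inside the range of an injective homomorphism
  `ψ : A →* B` pulls back to a realization in `A` (transport tool);
* `tpp_perm_fin_four_433`, `tpp_perm_fin_four_332` — `S₄` realizes `⟨4,3,3⟩`; an even (`A₄`) triple
  realizing `⟨3,3,2⟩` (`decide`); private `perm_fin_four_even_is_square` (`decide`);
* `map_mk_normalizer_eq` — self-normalising passes to quotients by normal subgroups below `S`;
* `HedtkeMurthy2012_lemma42` — **Lemma 4.2**: `S.index = 4`, `normalizer S = S` ⇒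
  `∃ n m p, RealizesTPP G n m p ∧ 2 · (n m p) = 3 · |G|` (i.e. `β(G) ≥ (3/2)|G|`).

## References
* I. Hedtke, S. Murthy, arXiv:1104.5097 = Groups Complex. Cryptol. 4 (2012): Lemma 4.2 with proof (after
  P. M. Neumann), §4; Table (tab:small) (`β(A₄) = 18`, `β(S₄) = 36`). [HedtkeMurthy2012]
* H. Cohn, C. Umans, FOCS 2003, arXiv:math/0307321: Lemma 2.2. [CohnUmans2003]
-/

namespace Literature.Computability.AlgebraicComplexity

open Literature.Combinatorics.Additive Equiv

/-! ## Transport: a TPP triple inside the range of an injective homomorphism pulls back -/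

/-- If `ψ : A →* B` is injective and `(S, T, U)` is a TPP triple of `B` contained in the range of `ψ`,
then `A` realizes `⟨|S|, |T|, |U|⟩` (through the preimages; the TPP relation in `A` maps to one in `B`,
and the resulting equalities reflect along the injective `ψ`). [folklore] (the transport implicit in
"`G/K ≅ img φ`" of [cite: HedtkeMurthy2012, Lemma 4.2 (proof)]) -/
theorem realizesTPP_of_tpp_subset_range {A B : Type*} [Group A] [Group B] (ψ : A →* B)
    (hψ : Function.Injective ψ) {S T U : Finset B} (hS : ∀ x ∈ S, x ∈ Set.range ψ)
    (hT : ∀ x ∈ T, x ∈ Set.range ψ) (hU : ∀ x ∈ U, x ∈ Set.range ψ)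
    (h : TripleProductProperty S T U) : RealizesTPP A S.card T.card U.card := by
  classical
  refine ⟨S.preimage ψ (hψ.injOn), T.preimage ψ (hψ.injOn), U.preimage ψ (hψ.injOn), ?_, ?_, ?_, ?_⟩
  · rw [Finset.card_preimage, Finset.filter_true_of_mem hS]
  · rw [Finset.card_preimage, Finset.filter_true_of_mem hT]
  · rw [Finset.card_preimage, Finset.filter_true_of_mem hU]
  · intro s hs s' hs' t ht t' ht' u hu u' hu' hrel
    simp only [Finset.mem_preimage] at hs hs' ht ht' hu hu'
    have hrel' : ψ s * (ψ s')⁻¹ * (ψ t * (ψ t')⁻¹) * (ψ u * (ψ u')⁻¹) = 1 := by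
      simpa only [map_mul, map_inv, map_one] using congrArg ψ hrel
    obtain ⟨h1, h2, h3⟩ := h _ hs _ hs' _ ht _ ht' _ hu _ hu' hrel'
    exact ⟨hψ h1, hψ h2, hψ h3⟩

/-! ## The two witnesses in `S₄` (print: `β(S₄) = 36`, `β(A₄) = 18`, Table (tab:small)) -/

/-- `S₄` realizes `⟨4, 3, 3⟩` through `{1, (23), (01), (01)(23)}`, `{1, (12), (123)}`, `{1, (02), (032)}`
(a TPP triple of volume `36 = (3/2)·|S₄|`). [cite: HedtkeMurthy2012, Table (tab:small) (`β(S₄) = 36`)] -/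
theorem tpp_perm_fin_four_433 :
    TripleProductProperty ({1, swap 2 3, swap 0 1, swap 0 1 * swap 2 3} : Finset (Perm (Fin 4)))
      {1, swap 1 2, swap 1 2 * swap 2 3} {1, swap 0 2, swap 0 3 * swap 0 2} := by
  unfold TripleProductProperty
  decide +kernel

/-- An EVEN triple realizing `⟨3, 3, 2⟩` in `S₄` (it lies in `A₄`; volume `18 = (3/2)·|A₄|`):
`{1, (123), (132)}`, `{1, (012), (021)}`, `{1, (03)(12)}`.
[cite: HedtkeMurthy2012, Table (tab:small) (`β(A₄) = 18`)] -/
theorem tpp_perm_fin_four_332 :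
    TripleProductProperty ({1, swap 1 2 * swap 2 3, swap 2 3 * swap 1 2} : Finset (Perm (Fin 4)))
      {1, swap 0 1 * swap 1 2, swap 1 2 * swap 0 1} {1, swap 0 3 * swap 1 2} := by
  unfold TripleProductProperty
  decide +kernel

/-- Every even permutation of four letters is a square (`1 = 1²`, a `3`-cycle `c = (c²)²`, a double
transposition `(ab)(cd) = (acbd)²`); private helper replacing the print's appeal to the list of
transitive subgroups of `S₄`. [folklore] -/
private theorem perm_fin_four_even_is_square :
    ∀ σ : Perm (Fin 4), Perm.sign σ = 1 → ∃ τ : Perm (Fin 4), τ * τ = σ := by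
  decide

/-! ## Self-normalising passes to quotients -/

variable {G : Type*} [Group G]

/-- If `N ⊴ G`, `N ≤ S` and `S` is self-normalising, then `S/N` is self-normalising in `G/N` (a `g`
whose image normalises `S/N` normalises `S N = S`). [folklore] (the step "Because `S` is
self-normalising …" of [cite: HedtkeMurthy2012, Lemma 4.2 (proof)]) -/
theorem map_mk_normalizer_eq (N S : Subgroup G) [N.Normal] (hNS : N ≤ S)
    (hSN : Subgroup.normalizer (S : Set G) = S) :
    Subgroup.normalizer ((S.map (QuotientGroup.mk' N) : Subgroup (G ⧸ N)) : Set (G ⧸ N)) =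
      S.map (QuotientGroup.mk' N) := by
  refine le_antisymm ?_ Subgroup.le_normalizer
  intro x hx
  obtain ⟨g, rfl⟩ := QuotientGroup.mk'_surjective N x
  have hmem : ∀ h : G, h ∈ S ↔ QuotientGroup.mk' N h ∈ S.map (QuotientGroup.mk' N) := fun h => by
    constructor
    · exact fun hh => Subgroup.mem_map_of_mem _ hh
    · rintro ⟨s, hs, hsh⟩
      rw [QuotientGroup.mk'_apply, QuotientGroup.mk'_apply, QuotientGroup.eq] at hsh
      have h' : s * (s⁻¹ * h) ∈ S := S.mul_mem hs (hNS hsh)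
      rwa [mul_inv_cancel_left] at h'
  have hg : g ∈ Subgroup.normalizer (S : Set G) := by
    rw [Subgroup.mem_normalizer_iff]
    intro h
    rw [hmem h, hmem (g * h * g⁻¹), map_mul, map_mul, map_inv]
    exact (Subgroup.mem_normalizer_iff.1 hx) _
  rw [hSN] at hg
  exact Subgroup.mem_map_of_mem _ hg

/-! ## Lemma 4.2 -/

/-- **Hedtke–Murthy 2012, Lemma 4.2** ("If `G` is a nonabelian group with a self-normalising subgroup
`S` of index `[G:S] = 4`, then `β(G) ≥ (3/2)|G|`"): a finite group with a self-normalising subgroup of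
index `4` realizes some `⟨n, m, p⟩` with `2 nmp = 3 |G|` — namely `⟨4|K|, 3, 3⟩` if `G/K ≅ S₄` and
`⟨3|K|, 3, 2⟩` if `G/K ≅ A₄`, `K = Core_G(S)`. [cite: HedtkeMurthy2012, Lemma 4.2] -/
theorem HedtkeMurthy2012_lemma42 [Finite G] (S : Subgroup G) (hS : S.index = 4)
    (hSN : Subgroup.normalizer (S : Set G) = S) :
    ∃ n m p : ℕ, RealizesTPP G n m p ∧ 2 * (n * m * p) = 3 * Nat.card G := by
  classical
  haveI : S.FiniteIndex := ⟨by rw [hS]; decide⟩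
  -- `S` is not normal (a normal subgroup has normaliser `⊤ ≠ S`)
  have hSn : ¬ S.Normal := by
    intro hn
    have h1 : S = ⊤ := by
      rw [← hSN]
      exact Subgroup.normalizer_eq_top_iff.2 hn
    rw [h1, Subgroup.index_top] at hS
    exact absurd hS (by decide)
  -- `[G : K] = r · 4` with `r ∣ 6`, `r ≠ 1`
  set K := S.normalCore with hK
  have hdvd : K.index ∣ Nat.factorial S.index := by
    rw [hK, Subgroup.normalCore_eq_ker, Subgroup.index_ker, Subgroup.index_eq_card, ← Nat.card_perm]
    exact Subgroup.card_subgroup_dvd_card (MulAction.toPermHom G (G ⧸ S)).range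
  rw [hS, show Nat.factorial 4 = 6 * 4 by decide] at hdvd
  have hmul : K.relIndex S * 4 = K.index := by
    rw [← hS]
    exact Subgroup.relIndex_mul_index S.normalCore_le
  have hr1 : K.relIndex S ≠ 1 := by
    intro h1
    apply hSn
    have hle : S ≤ K := Subgroup.relIndex_eq_one.1 h1
    have heq : K = S := le_antisymm S.normalCore_le hle
    rw [← heq, hK]
    exact S.normalCore_normal
  rw [← hmul] at hdvd
  have hr6 : K.relIndex S ∣ 6 := (Nat.mul_dvd_mul_iff_right (by norm_num : 0 < 4)).1 hdvd
  have hrcases : K.relIndex S = 2 ∨ K.relIndex S = 3 ∨ K.relIndex S = 6 := by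
    have hmem : K.relIndex S ∈ Nat.divisors 6 := Nat.mem_divisors.2 ⟨hr6, by norm_num⟩
    have h6d : Nat.divisors 6 = {1, 2, 3, 6} := by decide
    rw [h6d] at hmem
    simp only [Finset.mem_insert, Finset.mem_singleton] at hmem
    rcases hmem with h | h | h | h
    · exact absurd h hr1
    · exact Or.inl h
    · exact Or.inr (Or.inl h)
    · exact Or.inr (Or.inr h)
  -- the quotient `Q = G/K` and its faithful action on the four cosets of `S`
  haveI : K.Normal := by rw [hK]; exact S.normalCore_normal
  have hcardQ : Nat.card (G ⧸ K) = K.index := (Subgroup.index_eq_card K).symm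
  letI : Fintype (G ⧸ S) := Fintype.ofFinite _
  have hcardS : Fintype.card (G ⧸ S) = 4 := by
    rw [← Nat.card_eq_fintype_card, ← Subgroup.index_eq_card, hS]
  let e : G ⧸ S ≃ Fin 4 := Fintype.equivFinOfCardEq hcardS
  let φ : G →* Perm (G ⧸ S) := MulAction.toPermHom G (G ⧸ S)
  have hKker : K = φ.ker := by rw [hK]; exact Subgroup.normalCore_eq_ker S
  let ψ : G ⧸ K →* Perm (Fin 4) :=
    (e.permCongrHom.toMonoidHom.comp (QuotientGroup.kerLift φ)).comp
      (QuotientGroup.quotientMulEquivOfEq hKker).toMonoidHom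
  have hψ : Function.Injective ψ :=
    ((e.permCongrHom.injective.comp (QuotientGroup.kerLift_injective φ)).comp
      (QuotientGroup.quotientMulEquivOfEq hKker).injective)
  have hcardR : Nat.card ψ.range = K.index := by
    rw [← hcardQ]
    exact Nat.card_congr (MonoidHom.ofInjective hψ).toEquiv.symm
  have hcardP : Nat.card (Perm (Fin 4)) = 24 := by
    rw [Nat.card_perm, Nat.card_eq_fintype_card, Fintype.card_fin]; rfl
  -- `K` realizes `⟨|K|, 1, 1⟩`
  letI : Fintype K := Fintype.ofFinite _
  have hKreal : RealizesTPP K (Nat.card K) 1 1 := by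
    rw [Nat.card_eq_fintype_card]
    exact (realizesTPP_one_one_card (G := K)).rotate.rotate
  have hGK : Nat.card G = Nat.card K * K.index := (K.card_mul_index).symm
  rcases hrcases with h2 | h3 | h6
  · -- `[G : K] = 8`: a `2`-group; `S/K` self-normalising and proper — impossible
    exfalso
    have h8 : K.index = 8 := by rw [← hmul, h2]
    haveI : Fact (Nat.Prime 2) := ⟨Nat.prime_two⟩
    have hQ8 : Nat.card (G ⧸ K) = 2 ^ 3 := by rw [hcardQ, h8]; norm_num
    have hp : IsPGroup 2 (G ⧸ K) := IsPGroup.of_card hQ8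
    haveI : Group.IsNilpotent (G ⧸ K) := hp.isNilpotent
    have hNC := Group.normalizerCondition_of_isNilpotent (G := G ⧸ K)
    rw [normalizerCondition_iff_only_full_group_self_normalizing] at hNC
    have htop := hNC _ (map_mk_normalizer_eq K S S.normalCore_le hSN)
    have hidx : (S.map (QuotientGroup.mk' K)).index = 4 := by
      rw [Subgroup.index_map_eq S (QuotientGroup.mk'_surjective K)
        (by rw [QuotientGroup.ker_mk']; exact S.normalCore_le), hS]
    rw [htop, Subgroup.index_top] at hidx
    exact absurd hidx (by decide)
  · -- `[G : K] = 12`: the image has index `2` in `S₄`, so it contains all squares, hence `A₄`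
    have h12 : K.index = 12 := by rw [← hmul, h3]
    have hRi : ψ.range.index = 2 := by
      have h := ψ.range.card_mul_index
      rw [hcardR, h12, hcardP] at h
      omega
    have hmem : ∀ x : Perm (Fin 4), Perm.sign x = 1 → x ∈ Set.range ψ := fun x hx => by
      obtain ⟨τ, rfl⟩ := perm_fin_four_even_is_square x hx
      have hτ : τ * τ ∈ ψ.range := Subgroup.mul_self_mem_of_index_two hRi τ
      exact hτ
    have hQ : RealizesTPP (G ⧸ K) 3 3 2 := by
      have h := realizesTPP_of_tpp_subset_range ψ hψ (fun x hx => hmem x (by revert x; decide))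
        (fun x hx => hmem x (by revert x; decide)) (fun x hx => hmem x (by revert x; decide))
        tpp_perm_fin_four_332
      have hc : (({1, swap 1 2 * swap 2 3, swap 2 3 * swap 1 2} : Finset (Perm (Fin 4))).card = 3 ∧
          ({1, swap 0 1 * swap 1 2, swap 1 2 * swap 0 1} : Finset (Perm (Fin 4))).card = 3 ∧
          ({1, swap 0 3 * swap 1 2} : Finset (Perm (Fin 4))).card = 2) := by decide
      rw [hc.1, hc.2.1, hc.2.2] at h
      exact h
    refine ⟨Nat.card K * 3, 1 * 3, 1 * 2, CohnUmans2003_lemma22 K hKreal hQ, ?_⟩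
    rw [hGK, h12]; ring
  · -- `[G : K] = 24`: `G/K ≅ S₄`
    have h24 : K.index = 24 := by rw [← hmul, h6]
    have htop : ψ.range = ⊤ := Subgroup.eq_top_of_card_eq _ (by rw [hcardR, h24, hcardP])
    have hmem : ∀ x : Perm (Fin 4), x ∈ Set.range ψ := fun x => by
      have hx : x ∈ ψ.range := by rw [htop]; exact Subgroup.mem_top x
      exact hx
    have hQ : RealizesTPP (G ⧸ K) 4 3 3 := by
      have h := realizesTPP_of_tpp_subset_range ψ hψ (fun x _ => hmem x) (fun x _ => hmem x)
        (fun x _ => hmem x) tpp_perm_fin_four_433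
      have hc : (({1, swap 2 3, swap 0 1, swap 0 1 * swap 2 3} : Finset (Perm (Fin 4))).card = 4 ∧
          ({1, swap 1 2, swap 1 2 * swap 2 3} : Finset (Perm (Fin 4))).card = 3 ∧
          ({1, swap 0 2, swap 0 3 * swap 0 2} : Finset (Perm (Fin 4))).card = 3) := by decide
      rw [hc.1, hc.2.1, hc.2.2] at h
      exact h
    refine ⟨Nat.card K * 4, 1 * 3, 1 * 3, CohnUmans2003_lemma22 K hKreal hQ, ?_⟩
    rw [hGK, h24]; ring

end Literature.Computability.AlgebraicComplexity
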